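import Summits.PneNP.PneNP.Theorems.RegularResolutionRung.Negative.OneSidedFalse
import Literature.Computability.MetaComplexity.ResolutionRestrictionMap

/-!
# Crux `RamseyUncertifiable.ResolutionUncertainty` (stmt-PneNP-9816), line
# `box-dag-self-gadget-lifting`: stub `stub_restrictRefutation`

Refutations of the unary clique CNF `cliqueCNF n k adj` only shrink under passing to an induced
sub-table along an injection `e : Fin m ↪ Fin n` (ABdRLNR arXiv:2012.09476, Fact 3.2 / Fact 2.1,
for this CNF and the tree's resolution system `IsResRefutation`).

Proof: apply the tree's restriction-and-renaming transfer
`IsResRefutation.exists_map_restrict` (Ben-Sasson–Wigderson 2001, §2.2) with the partial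
assignment setting every block variable `x_{i,v}` with `v ∉ range e` to `false`, and the renaming
`x_{i,e a} ↦ x_{i,a}` (`i < k`), junk variables `w ≥ k·n ↦ k·m + (w - k·n)`; block axioms map to
block axioms, functionality / edge axioms inside the range map to the corresponding axioms, and
every other axiom contains a satisfied (negative, dead) literal. No new definitions: the
restriction pair is produced existentially (`exists_restriction`). [folklore]
-/

namespace Summit.PneNP.PneNP.Theorems.RamseyUncertifiableResolutionUncertainty

open Literature.Computability.Complexity Literature.Computability.MetaComplexity
open Summit.PneNP.PneNP.Theorems.RegularResolutionRung.Negative (cliqueCNF)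
open Summit.PneNP.PneNP.Theorems.RegularResolutionRung.Negative
  (block_mem edge_mem mem_clauseFinsets digits_of)

namespace RestrictRefutation

variable {n m k : ℕ} {e : Fin m ↪ Fin n}

/-- Block variables of blocks `i < k` lie below `k·n`. -/
theorem blockVar_lt {i v : ℕ} (hi : i < k) (hv : v < n) : i * n + v < k * n := by
  have h := Nat.mul_le_mul_right n (Nat.succ_le_of_lt hi)
  rw [Nat.succ_mul] at h
  omega

/-- Block-variable numbering `(i, a) ↦ i·m + a` (`a < m`) is injective. -/
theorem blockVar_inj {i j : ℕ} {a b : Fin m} (h : i * m + (a : ℕ) = j * m + (b : ℕ)) :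
    i = j ∧ a = b := by
  have h1 := (digits_of (n := m) (s := i) a.isLt).1
  have h2 := (digits_of (n := m) (s := j) b.isLt).1
  have hij : i = j := by rw [← h1, h, h2]
  subst hij
  exact ⟨rfl, Fin.ext (by omega)⟩

/-- **The restriction pair.** There are a partial assignment `ρ` of the variables `ℕ` and a
renaming `r : ℕ → ℕ` such that: a block variable `x_{i,v}` (`i < k`) is unassigned iff
`v ∈ range e` and is set to `false` otherwise; `x_{i,e a}` is renamed to `i·m + a`; and `r` is
injective on the unassigned variables. (Explicitly: `ρ` kills `w < k·n` with `w % n ∉ range e`;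
`r (i·n + e a) = i·m + a`, and junk variables `w ≥ k·n` go to `k·m + (w - k·n)`.) -/
theorem exists_restriction (n m k : ℕ) (e : Fin m ↪ Fin n) :
    ∃ (ρ : ℕ → Option Bool) (r : ℕ → ℕ),
      (∀ i, i < k → ∀ v : Fin n, (ρ (i * n + (v : ℕ)) = none ↔ ∃ a : Fin m, e a = v)) ∧
      (∀ i, i < k → ∀ v : Fin n, (¬ ∃ a : Fin m, e a = v) → ρ (i * n + (v : ℕ)) = some false) ∧
      (∀ i, i < k → ∀ a : Fin m, r (i * n + ((e a : Fin n) : ℕ)) = i * m + (a : ℕ)) ∧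
      (∀ x y, ρ x = none → ρ y = none → r x = r y → x = y) := by
  classical
  let ρ : ℕ → Option Bool := fun w =>
    if w < k * n ∧ ¬ ∃ a : Fin m, ((e a : Fin n) : ℕ) = w % n then some false else none
  let r : ℕ → ℕ := fun w =>
    if w < k * n then
      (if h : ∃ a : Fin m, ((e a : Fin n) : ℕ) = w % n then w / n * m + (Classical.choose h).val
        else 0)
    else k * m + (w - k * n)
  have hρ : ∀ w, ρ w =
      if w < k * n ∧ ¬ ∃ a : Fin m, ((e a : Fin n) : ℕ) = w % n then some false else none :=
    fun w => rfl
  have hr : ∀ w, r w =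
      if w < k * n then
        (if h : ∃ a : Fin m, ((e a : Fin n) : ℕ) = w % n then w / n * m + (Classical.choose h).val
          else 0)
      else k * m + (w - k * n) := fun w => rfl
  -- live block variables
  have live : ∀ i, i < k → ∀ v : Fin n, (ρ (i * n + (v : ℕ)) = none ↔ ∃ a : Fin m, e a = v) := by
    intro i hi v
    rw [hρ, (digits_of (s := i) v.isLt).2]
    by_cases hex : ∃ a : Fin m, e a = v
    · rw [if_neg (fun h => h.2 (hex.imp fun a ha => congrArg Fin.val ha))]
      exact iff_of_true rfl hex
    · rw [if_pos ⟨blockVar_lt hi v.isLt, fun ⟨a, ha⟩ => hex ⟨a, Fin.ext ha⟩⟩]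
      exact iff_of_false (by simp) hex
  -- dead block variables
  have dead : ∀ i, i < k → ∀ v : Fin n, (¬ ∃ a : Fin m, e a = v) →
      ρ (i * n + (v : ℕ)) = some false := by
    intro i hi v hv
    rw [hρ, (digits_of (s := i) v.isLt).2,
      if_pos ⟨blockVar_lt hi v.isLt, fun ⟨a, ha⟩ => hv ⟨a, Fin.ext ha⟩⟩]
  -- renaming of live block variables
  have ren : ∀ i, i < k → ∀ a : Fin m, r (i * n + ((e a : Fin n) : ℕ)) = i * m + (a : ℕ) := by
    intro i hi a
    rw [hr, if_pos (blockVar_lt hi (e a).isLt)]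
    have h : ∃ a' : Fin m, ((e a' : Fin n) : ℕ) = (i * n + ((e a : Fin n) : ℕ)) % n :=
      ⟨a, by rw [(digits_of (s := i) (e a).isLt).2]⟩
    rw [dif_pos h, (digits_of (s := i) (e a).isLt).1]
    have hch : Classical.choose h = a :=
      e.injective (Fin.ext ((Classical.choose_spec h).trans (digits_of (s := i) (e a).isLt).2))
    rw [hch]
  -- renaming of junk variables
  have junk : ∀ w, k * n ≤ w → r w = k * m + (w - k * n) := by
    intro w hw
    rw [hr, if_neg (Nat.not_lt.2 hw)]
  -- an unassigned variable is a live block variable or a junk variable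
  have decode : ∀ w, ρ w = none →
      (∃ i, i < k ∧ ∃ a : Fin m, w = i * n + ((e a : Fin n) : ℕ)) ∨ k * n ≤ w := by
    intro w hw
    by_cases hlt : w < k * n
    · left
      have hn : 0 < n := Nat.pos_of_ne_zero (by rintro rfl; simp at hlt)
      rw [hρ] at hw
      have hex : ∃ a : Fin m, ((e a : Fin n) : ℕ) = w % n := by
        by_contra hne
        rw [if_pos ⟨hlt, hne⟩] at hw
        simp at hw
      obtain ⟨a, ha⟩ := hex
      refine ⟨w / n, (Nat.div_lt_iff_lt_mul hn).2 hlt, a, ?_⟩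
      have h := Nat.div_add_mod' w n
      omega
    · exact Or.inr (Nat.not_lt.1 hlt)
  -- injectivity on unassigned variables
  have inj : ∀ x y, ρ x = none → ρ y = none → r x = r y → x = y := by
    intro x y hx hy hxy
    rcases decode x hx with ⟨i, hi, a, rfl⟩ | hxk <;>
      rcases decode y hy with ⟨j, hj, b, rfl⟩ | hyk
    · rw [ren i hi, ren j hj] at hxy
      obtain ⟨rfl, hab⟩ := blockVar_inj hxy
      rw [hab]
    · exfalso
      rw [ren i hi, junk y hyk] at hxy
      have := blockVar_lt (n := m) hi a.isLt
      omega
    · exfalso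
      rw [junk x hxk, ren j hj] at hxy
      have := blockVar_lt (n := m) hj b.isLt
      omega
    · rw [junk x hxk, junk y hyk] at hxy
      omega
  exact ⟨ρ, r, live, dead, ren, inj⟩

/-- The functionality clause `¬x_{i,u} ∨ ¬x_{i,v}` (`i < k`, `u < v`) is an axiom of `cliqueCNF`. -/
theorem func_mem {n : ℕ} (k i : ℕ) (hi : i < k) (adj : Fin n → Fin n → Bool) (u v : Fin n)
    (huv : (u : ℕ) < (v : ℕ)) :
    [(i * n + (u : ℕ), false), (i * n + (v : ℕ), false)] ∈ cliqueCNF n k adj := by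
  unfold cliqueCNF
  refine List.mem_append.2 (Or.inl (List.mem_append.2 (Or.inr ?_)))
  refine List.mem_flatMap.2 ⟨i, List.mem_range.2 hi, List.mem_flatMap.2 ⟨(u : ℕ), by simp,
    List.mem_flatMap.2 ⟨(v : ℕ), by simp, ?_⟩⟩⟩
  rw [if_pos huv]
  exact List.mem_singleton.2 rfl

/-- Membership in the block clause `⋁_v x_{i,v}` (as the list over the coerced `List.finRange`). -/
theorem mem_blockClause {n i : ℕ} {l : Literal ℕ} :
    l ∈ ((List.finRange n).map fun v => (i * n + (v : ℕ), true)) ↔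
      ∃ v : Fin n, (i * n + (v : ℕ), true) = l := by
  simp only [List.mem_map, List.pure_def, List.bind_eq_flatMap, List.mem_flatMap,
    List.mem_finRange, List.mem_cons, List.not_mem_nil, or_false, true_and]
  constructor
  · rintro ⟨w, ⟨a, rfl⟩, h⟩
    exact ⟨a, h⟩
  · rintro ⟨a, h⟩
    exact ⟨(a : ℕ), ⟨a, rfl⟩, h⟩

/-- Under a restriction pair, the block axiom of block `i` restricts-and-renames to the block
axiom of block `i` over `m` vertices. -/
theorem image_block {ρ : ℕ → Option Bool} {r : ℕ → ℕ} {i : ℕ}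
    (hlive : ∀ v : Fin n, ρ (i * n + (v : ℕ)) = none ↔ ∃ a : Fin m, e a = v)
    (hren : ∀ a : Fin m, r (i * n + ((e a : Fin n) : ℕ)) = i * m + (a : ℕ)) :
    (restrictClause ρ (((List.finRange n).map fun v => (i * n + (v : ℕ), true)).toFinset)).image
        (fun l => ((r l.1, l.2) : Literal ℕ)) =
      ((List.finRange m).map fun a => (i * m + (a : ℕ), true)).toFinset := by
  ext l
  simp only [Finset.mem_image, mem_restrictClause, List.mem_toFinset, mem_blockClause]
  constructor
  · rintro ⟨l', ⟨⟨v, rfl⟩, hl'⟩, rfl⟩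
    obtain ⟨a, rfl⟩ := (hlive v).1 hl'
    exact ⟨a, Prod.ext (hren a).symm rfl⟩
  · rintro ⟨a, rfl⟩
    exact ⟨(i * n + ((e a : Fin n) : ℕ), true), ⟨⟨e a, rfl⟩, (hlive (e a)).2 ⟨a, rfl⟩⟩,
      Prod.ext (hren a) rfl⟩

/-- Restricting-and-renaming a two-literal negative clause on unassigned variables. -/
theorem image_pair {ρ : ℕ → Option Bool} (r : ℕ → ℕ) {x y : ℕ} (hx : ρ x = none)
    (hy : ρ y = none) :
    (restrictClause ρ ([(x, false), (y, false)].toFinset)).image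
        (fun l => ((r l.1, l.2) : Literal ℕ)) = [(r x, false), (r y, false)].toFinset := by
  have hres : restrictClause ρ ([(x, false), (y, false)].toFinset) =
      [(x, false), (y, false)].toFinset := by
    refine Finset.Subset.antisymm restrictClause_subset (fun l hl => ?_)
    rw [mem_restrictClause]
    refine ⟨hl, ?_⟩
    simp only [List.toFinset_cons, List.toFinset_nil, Finset.mem_insert,
      Finset.notMem_empty, or_false] at hl
    rcases hl with rfl | rfl
    · exact hx
    · exact hy
  rw [hres]
  simp [Finset.image_insert]

/-- Under a restriction pair, every axiom of `cliqueCNF n k adj` is satisfied or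
restricts-and-renames to an axiom of the induced CNF `cliqueCNF m k (adj ∘ e)`. -/
theorem clause_transfer (adj : Fin n → Fin n → Bool) {ρ : ℕ → Option Bool} {r : ℕ → ℕ}
    (hlive : ∀ i, i < k → ∀ v : Fin n, (ρ (i * n + (v : ℕ)) = none ↔ ∃ a : Fin m, e a = v))
    (hdead : ∀ i, i < k → ∀ v : Fin n, (¬ ∃ a : Fin m, e a = v) → ρ (i * n + (v : ℕ)) = some false)
    (hren : ∀ i, i < k → ∀ a : Fin m, r (i * n + ((e a : Fin n) : ℕ)) = i * m + (a : ℕ)) :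
    ∀ C ∈ (cliqueCNF n k adj).clauseFinsets, SatisfiedBy ρ C ∨
      (restrictClause ρ C).image (fun l => ((r l.1, l.2) : Literal ℕ)) ∈
        (cliqueCNF m k fun a b => adj (e a) (e b)).clauseFinsets := by
  intro C hC
  unfold CNF.clauseFinsets at hC
  obtain ⟨c, hc, rfl⟩ := List.mem_map.1 hC
  simp only [cliqueCNF, List.mem_append] at hc
  rcases hc with (hc | hc) | hc
  · -- block axioms
    obtain ⟨i, hi, rfl⟩ := List.mem_map.1 hc
    have hi : i < k := List.mem_range.1 hi
    right
    rw [image_block (hlive i hi) (hren i hi)]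
    exact mem_clauseFinsets (block_mem k i hi _)
  · -- functionality axioms
    obtain ⟨i, hi, hc⟩ := List.mem_flatMap.1 hc
    have hi : i < k := List.mem_range.1 hi
    obtain ⟨u, hu, hc⟩ := List.mem_flatMap.1 hc
    obtain ⟨v, hv, hc⟩ := List.mem_flatMap.1 hc
    obtain ⟨u, rfl⟩ : ∃ a : Fin n, u = (a : ℕ) := by simpa using hu
    obtain ⟨v, rfl⟩ : ∃ a : Fin n, v = (a : ℕ) := by simpa using hv
    split_ifs at hc with huv
    · have hc := List.mem_singleton.1 hc
      subst hc
      by_cases hu : ∃ a : Fin m, e a = u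
      · by_cases hv : ∃ b : Fin m, e b = v
        · right
          obtain ⟨a, rfl⟩ := hu
          obtain ⟨b, rfl⟩ := hv
          rw [image_pair r ((hlive i hi (e a)).2 ⟨a, rfl⟩) ((hlive i hi (e b)).2 ⟨b, rfl⟩),
            hren i hi a, hren i hi b]
          rcases lt_trichotomy a b with hab | rfl | hba
          · exact mem_clauseFinsets (func_mem k i hi _ a b hab)
          · exact absurd huv (lt_irrefl _)
          · have hsw : [(i * m + (a : ℕ), false), (i * m + (b : ℕ), false)].toFinset =
                [(i * m + (b : ℕ), false), (i * m + (a : ℕ), false)].toFinset := by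
              simp only [List.toFinset_cons, List.toFinset_nil, Finset.insert_empty]
              exact Finset.pair_comm _ _
            rw [hsw]
            exact mem_clauseFinsets (func_mem k i hi _ b a hba)
        · left
          exact ⟨(i * n + (v : ℕ), false), by simp, hdead i hi v hv⟩
      · left
        exact ⟨(i * n + (u : ℕ), false), by simp, hdead i hi u hu⟩
    · exact absurd hc List.not_mem_nil
  · -- edge axioms
    obtain ⟨i, hi, hc⟩ := List.mem_flatMap.1 hc
    have hi : i < k := List.mem_range.1 hi
    obtain ⟨j, hj, hc⟩ := List.mem_flatMap.1 hc
    have hj : j < k := List.mem_range.1 hj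
    obtain ⟨u, -, hc⟩ := List.mem_flatMap.1 hc
    obtain ⟨v, -, hc⟩ := List.mem_flatMap.1 hc
    split_ifs at hc with hcond
    · have hc := List.mem_singleton.1 hc
      subst hc
      by_cases hu : ∃ a : Fin m, e a = u
      · by_cases hv : ∃ b : Fin m, e b = v
        · right
          obtain ⟨a, rfl⟩ := hu
          obtain ⟨b, rfl⟩ := hv
          rw [image_pair r ((hlive i hi (e a)).2 ⟨a, rfl⟩) ((hlive j hj (e b)).2 ⟨b, rfl⟩),
            hren i hi a, hren j hj b]
          exact mem_clauseFinsets (edge_mem k i j hi hj hcond.1 _ a b hcond.2)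
        · left
          exact ⟨(j * n + (v : ℕ), false), by simp, hdead j hj v hv⟩
      · left
        exact ⟨(i * n + (u : ℕ), false), by simp, hdead i hi u hu⟩
    · exact absurd hc List.not_mem_nil

/-- A refuted CNF has at least one clause (the first line of a refutation can only be an axiom). -/
theorem ne_nil_of_isResRefutation {φ : CNF ℕ} {π : List (ResLine ℕ)} (h : IsResRefutation φ π) :
    φ ≠ [] := by
  rintro rfl
  obtain ⟨hder, l, hl, -⟩ := h
  have hpos : 0 < π.length := List.length_pos_of_mem hl
  have hv := hder 0 hpos
  unfold IsValidResLine at hv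
  split at hv
  · simp [CNF.clauseFinsets] at hv
  · obtain ⟨hi, -⟩ := hv
    simp at hi
  · obtain ⟨hi, -⟩ := hv
    simp at hi

end RestrictRefutation

open RestrictRefutation in
/-- **Refutations only shrink under restriction** (ABdRLNR arXiv:2012.09476, Fact 3.2 / Fact 2.1,
for the unary clique CNF): along an injection `e : Fin m ↪ Fin n`, every resolution refutation of
`Clique(adj, k)` on `n` vertices yields one of the induced `Clique(adj ∘ e, k)` on `m` vertices
that is no longer. -/
theorem stub_restrictRefutation :
    ∀ (n m k : ℕ) (adj : Fin n → Fin n → Bool) (e : Fin m ↪ Fin n) (π : List (ResLine ℕ)),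
      IsResRefutation (cliqueCNF n k adj) π →
      ∃ π' : List (ResLine ℕ),
        IsResRefutation (cliqueCNF m k fun a b => adj (e a) (e b)) π' ∧ π'.length ≤ π.length := by
  intro n m k adj e π hπ
  have hk : 0 < k := Nat.pos_of_ne_zero (by
    rintro rfl
    exact ne_nil_of_isResRefutation hπ (by simp [cliqueCNF]))
  have hψ : (cliqueCNF m k fun a b => adj (e a) (e b)) ≠ [] :=
    List.ne_nil_of_mem (block_mem k 0 hk _)
  obtain ⟨ρ, r, hlive, hdead, hren, hinj⟩ := exists_restriction n m k e
  obtain ⟨π', hπ', hlen⟩ := hπ.exists_map_restrict ρ r hinj hψ (clause_transfer adj hlive hdead hren)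
  exact ⟨π', hπ', hlen.le⟩

end Summit.PneNP.PneNP.Theorems.RamseyUncertifiableResolutionUncertainty
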